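import Mathlib.Analysis.Convex.Basic
import Mathlib.Analysis.Convex.Measure
import Mathlib.MeasureTheory.Measure.Lebesgue.Basic
import Mathlib.MeasureTheory.Constructions.Pi
import Mathlib.MeasureTheory.Measure.Prod
import Literature.NumberTheory.Sieve.LinearEquationsInPrimes
import HarnessLib

/-!
# Lattice points in convex bodies (Green–Tao 2010, Appendix A)

Trunk T-SIEVE (`Literature/NumberTheory/Sieve`). The "Gauss volume-packing argument" of
B. Green, T. Tao, *Linear equations in primes*, Ann. of Math. 171 (2010), Appendix A
("Elementary convex geometry"): for a convex body `K ⊆ [-N, N]^d`,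
`|K ∩ ℤ^d| = vol_d(K) + O_d(N^{d-1})` (the display following Cor. A.2, used there to prove
(1.3)), together with the boundary region estimate Cor. A.2 from which it is derived is NOT
vendored here (its `εN`-neighbourhood is Euclidean while Mathlib's metric on `Fin d → ℝ` is the
sup metric); only the norm-free lattice-point count is recorded.

This is the volume/lattice-point passage needed to fibre the generalised Hardy–Littlewood
conjecture over a coordinate (grounds the assembly step
`Summit.Parity.GeneralizedHardyLittlewood.Theses.DicksonFibration.Assembly`, which needs it
in dimension `d - 1` for the fibre-length weighted main terms).

Conventions are those of `LinearEquationsInPrimes.lean`: `Literature.latticeBox d N` is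
`[-N, N]^d ∩ ℤ^d`, `Literature.realPoint n` the real point of a lattice point, `Literature.realBox d N` the real
box `[-N, N]^d`; `K ∩ ℤ^d` for `K ⊆ [-N, N]^d` is the filter of the lattice box by membership of
the real point in `K` (as in `Literature.NumberTheory.Sieve.vonMangoldtSum`). Convex sets are null-measurable, so `volume K`
is the Lebesgue measure of `K`. `1 ≤ N` because for `N = 0`, `d ≥ 2`, `K = {0}` the printed
`O_d(N^{d-1})` would read `1 ≤ 0`; Green–Tao's `N` is "a large integer".

## Discharge

`GreenTao2010_latticePointsConvexBody_holds` proves the fact (explicit constant `C(d) = d 4^{d-1}`)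
by an elementary coordinate-by-coordinate Cavalieri argument, see the section docstring
`## Proof of GreenTao2010_latticePointsConvexBody` below (namespace `Literature.LatticePointsConvexBody`);
Green–Tao's own route via surface area (Lemma A.1, Cor. A.2) is not formalised.

## References

* B. Green, T. Tao, *Linear equations in primes*, Ann. of Math. (2) 171 (2010), 1753–1850
  (arXiv:math/0606088), Appendix A: Lemma A.1 (Archimedes comparison), Cor. A.2 (boundary region
  estimate), the display `|K ∩ ℤ^d| = vol_d(K) + O_d(N^{d-1})` proving (1.3), Cor. A.3.
-/

noncomputable section

open Finset MeasureTheory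

namespace Literature.NumberTheory.Sieve

open Classical in
/-- (Green–Tao 2010, Appendix A, the display after Cor. A.2, as printed:) "it suffices to show
that `|K ∩ ℤ^d| = vol_d(K) + O_d(N^{d-1})` for all convex bodies `K ⊆ [-N,N]^d`. However, given
that `|K ∩ ℤ^d|` is equal to the volume of the set `(K ∩ ℤ^d) + [-1/2,1/2]^d`, which differs
from `K` only on the `O_d(1)`-neighbourhood of `∂K`, the claim then follows from Corollary A.2."
Rendered: for every `d ≥ 1` there is `C = C(d)` such that for all integers `N ≥ 1` and all convex
`K ⊆ [-N, N]^d`, `| #(K ∩ ℤ^d) - vol_d(K) | ≤ C N^{d-1}`.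
Grounds `Summit.Parity.GeneralizedHardyLittlewood.Theses.DicksonFibration.Assembly`
(volume/lattice-point passage for the fibre-length weighted main terms).
[cite: GreenTao2010, App. A (display after Cor. A.2)] -/
def GreenTao2010_latticePointsConvexBody : Prop :=
  ∀ d : ℕ, 1 ≤ d → ∃ C : ℝ, ∀ N : ℕ, 1 ≤ N → ∀ K : Set (Fin d → ℝ), Convex ℝ K → K ⊆ realBox d N →
    |(#((latticeBox d N).filter fun n => realPoint n ∈ K) : ℝ) - (volume K).toReal| ≤
      C * (N : ℝ) ^ (d - 1)

/-- Sanity instance of the shape of the statement (not of its content): in dimension `1` with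
`K = ∅` the count and the volume both vanish, so any `C ≥ 0` works for that body. [folklore] -/
example (N : ℕ) :
    |(#((latticeBox 1 N).filter fun n => realPoint n ∈ (∅ : Set (Fin 1 → ℝ))) : ℝ) -
        (volume (∅ : Set (Fin 1 → ℝ))).toReal| ≤ 0 * (N : ℝ) ^ (1 - 1) := by
  simp

/-! ## Proof of `GreenTao2010_latticePointsConvexBody`

Not Green–Tao's surface-area route (Lemma A.1/Cor. A.2) but the elementary coordinate-by-coordinate
Cavalieri argument. Write `S = K ∩ ℤ^d`, `Q = [-1/2, 1/2]^d`, `K⁺ = K + Q`,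
`K⁻ = {x : x + Q ⊆ K}`. Half-open unit cubes centred at the points of `S` are disjoint and lie in
`K⁺`, so `#S ≤ vol K⁺`; every `x ∈ K⁻` rounds to a point of `S`, so `vol K⁻ ≤ #S`. Thickening
(resp. thinning) a convex subset of `[-M, M]^d` by the segment `[-1/2, 1/2] eᵢ` in ONE coordinate
direction changes each fibre in that direction — an interval — by length at most `1`, and only
fibres over the projected box `[-M, M]^{d-1}` are non-empty, so the volume changes by at most
`(2M)^{d-1}` (Fubini; convex sets are null-measurable, and the product formula for null-measurable
sets follows from the measurable case by a `toMeasurable` sandwich). Doing this for the `d`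
directions in turn gives `vol K⁺ ≤ vol K + d (2N+2)^{d-1}` and `vol K ≤ vol K⁻ + d (2N)^{d-1}`,
whence `|#S - vol K| ≤ d (2N+2)^{d-1} ≤ d 4^{d-1} N^{d-1}` for `N ≥ 1`. -/

namespace LatticePointsConvexBody

open Set
open scoped Pointwise ENNReal

/-! ### Fubini for null-measurable sets -/

section Fubini

variable {α β : Type*} [MeasurableSpace α] [MeasurableSpace β] {μ : Measure α} {ν : Measure β}
  [SFinite μ] [SFinite ν]

/-- The integral of the fibre measures of ANY set is at most its (outer) product measure.
[folklore] -/
theorem lintegral_fibre_le (s : Set (α × β)) :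
    ∫⁻ y, μ ((fun x => (x, y)) ⁻¹' s) ∂ν ≤ μ.prod ν s := by
  calc ∫⁻ y, μ ((fun x => (x, y)) ⁻¹' s) ∂ν
        ≤ ∫⁻ y, μ ((fun x => (x, y)) ⁻¹' toMeasurable (μ.prod ν) s) ∂ν :=
        lintegral_mono fun y => measure_mono (preimage_mono (subset_toMeasurable _ _))
    _ = μ.prod ν (toMeasurable (μ.prod ν) s) :=
        (Measure.prod_apply_symm (measurableSet_toMeasurable _ _)).symm
    _ = μ.prod ν s := measure_toMeasurable s

/-- Fubini–Tonelli for a null-measurable set. [folklore] -/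
theorem le_lintegral_fibre {s : Set (α × β)} (hs : NullMeasurableSet s (μ.prod ν)) :
    μ.prod ν s ≤ ∫⁻ y, μ ((fun x => (x, y)) ⁻¹' s) ∂ν := by
  obtain ⟨t, hts, ht, hts'⟩ := hs.exists_measurable_subset_ae_eq
  calc μ.prod ν s = μ.prod ν t := (measure_congr hts').symm
    _ = ∫⁻ y, μ ((fun x => (x, y)) ⁻¹' t) ∂ν := Measure.prod_apply_symm ht
    _ ≤ _ := lintegral_mono fun y => measure_mono (preimage_mono hts)

end Fubini

/-! ### One-dimensional intervals -/

/-- An interval of `ℝ` contains the open interval between its infimum and supremum.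
[folklore] -/
theorem Ioo_subset_of_ordConnected {S : Set ℝ} (hS : S.OrdConnected) (hne : S.Nonempty) :
    Ioo (sInf S) (sSup S) ⊆ S := by
  rintro t ⟨h1, h2⟩
  obtain ⟨s₁, hs₁, hs₁t⟩ := exists_lt_of_csInf_lt hne h1
  obtain ⟨s₂, hs₂, hts₂⟩ := exists_lt_of_lt_csSup hne h2
  exact hS.out hs₁ hs₂ ⟨hs₁t.le, hts₂.le⟩

/-- Thickening a bounded interval by `1/2` on each side adds at most `1` to its length.
[folklore] -/
theorem volume_thick_le {S : Set ℝ} (hS : S.OrdConnected) (hne : S.Nonempty)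
    (hb : BddBelow S) (ha : BddAbove S) :
    volume {t : ℝ | ∃ s ∈ S, |t - s| ≤ 1 / 2} ≤ volume S + 1 := by
  set a := sInf S
  set b := sSup S
  calc volume {t : ℝ | ∃ s ∈ S, |t - s| ≤ 1 / 2} ≤ volume (Icc (a - 1 / 2) (b + 1 / 2)) := by
        refine measure_mono ?_
        rintro t ⟨s, hs, hts⟩
        rw [abs_le] at hts
        exact ⟨by linarith [csInf_le hb hs], by linarith [le_csSup ha hs]⟩
    _ = ENNReal.ofReal ((b - a) + 1) := by rw [Real.volume_Icc]; congr 1; ring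
    _ ≤ ENNReal.ofReal (b - a) + ENNReal.ofReal 1 := ENNReal.ofReal_add_le
    _ = volume (Ioo a b) + 1 := by rw [Real.volume_Ioo, ENNReal.ofReal_one]
    _ ≤ volume S + 1 := by gcongr; exact Ioo_subset_of_ordConnected hS hne

/-- Thinning a bounded interval by `1/2` on each side removes at most `1` from its length.
[folklore] -/
theorem volume_le_thin {S : Set ℝ} (hS : S.OrdConnected) (hne : S.Nonempty)
    (hb : BddBelow S) (ha : BddAbove S) :
    volume S ≤ volume {t : ℝ | ∀ s, |t - s| ≤ 1 / 2 → s ∈ S} + 1 := by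
  set a := sInf S
  set b := sSup S
  calc volume S ≤ volume (Icc a b) := measure_mono fun s hs => ⟨csInf_le hb hs, le_csSup ha hs⟩
    _ = ENNReal.ofReal ((b - a - 1) + 1) := by rw [Real.volume_Icc]; congr 1; ring
    _ ≤ ENNReal.ofReal (b - a - 1) + ENNReal.ofReal 1 := ENNReal.ofReal_add_le
    _ = volume (Ioo (a + 1 / 2) (b - 1 / 2)) + 1 := by
        rw [Real.volume_Ioo, ENNReal.ofReal_one]; congr 2; ring
    _ ≤ _ := by
        gcongr
        rintro t ⟨h1, h2⟩ s hs
        rw [abs_le] at hs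
        exact Ioo_subset_of_ordConnected hS hne ⟨by linarith, by linarith⟩

/-! ### Fibres along a coordinate -/

variable {n : ℕ}

/-- The fibre of `A ⊆ ℝ^{n+1}` in the coordinate direction `i` over `x' ∈ ℝ^n`. [folklore] -/
def fibre (i : Fin (n + 1)) (A : Set (Fin (n + 1) → ℝ)) (x' : Fin n → ℝ) : Set ℝ :=
  {t | i.insertNth t x' ∈ A}

/-- Membership in a fibre, by definition. [folklore] -/
theorem mem_fibre {i : Fin (n + 1)} {A : Set (Fin (n + 1) → ℝ)} {x' : Fin n → ℝ} {t : ℝ} :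
    t ∈ fibre i A x' ↔ i.insertNth t x' ∈ A := Iff.rfl

/-- Fibres of convex sets are intervals. [folklore] -/
theorem ordConnected_fibre (i : Fin (n + 1)) {L : Set (Fin (n + 1) → ℝ)} (hL : Convex ℝ L)
    (x' : Fin n → ℝ) : (fibre i L x').OrdConnected := by
  refine ⟨fun t₁ h₁ t₂ h₂ t ht => ?_⟩
  rcases eq_or_lt_of_le (ht.1.trans ht.2) with h | h
  · have : t = t₁ := le_antisymm (h ▸ ht.2) ht.1
    rw [this]; exact h₁
  · set a := (t₂ - t) / (t₂ - t₁)
    set b := (t - t₁) / (t₂ - t₁)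
    have hd : 0 < t₂ - t₁ := sub_pos.2 h
    have ha : 0 ≤ a := div_nonneg (sub_nonneg.2 ht.2) hd.le
    have hb : 0 ≤ b := div_nonneg (sub_nonneg.2 ht.1) hd.le
    have hab : a + b = 1 := by
      simp only [a, b]; rw [← add_div, div_eq_one_iff_eq hd.ne']; ring
    have key : a • i.insertNth t₁ x' + b • i.insertNth t₂ x' = i.insertNth t x' := by
      refine Fin.eq_insertNth_iff.2 ⟨?_, ?_⟩
      · simp only [Pi.add_apply, Pi.smul_apply, Fin.insertNth_apply_same, smul_eq_mul]
        simp only [a, b]; field_simp; ring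
      · ext j
        simp only [Fin.removeNth, Pi.add_apply, Pi.smul_apply, Fin.insertNth_apply_succAbove,
          smul_eq_mul]
        rw [← add_mul, hab, one_mul]
    rw [mem_fibre, ← key]
    exact hL h₁ h₂ ha hb hab

/-- Fibres of a subset of the box `[-M, M]^{n+1}` lie in `[-M, M]`. [folklore] -/
theorem fibre_subset_Icc {A : Set (Fin (n + 1) → ℝ)} {M : ℝ} (hA : A ⊆ realBox (n + 1) M)
    (i : Fin (n + 1)) (x' : Fin n → ℝ) : fibre i A x' ⊆ Icc (-M) M := by
  intro t ht
  have h := hA ht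
  exact ⟨by simpa using h.1 i, by simpa using h.2 i⟩

/-- Only fibres over the box `[-M, M]^n` of a subset of `[-M, M]^{n+1}` are non-empty. [folklore] -/
theorem mem_Icc_of_mem_fibre {A : Set (Fin (n + 1) → ℝ)} {M : ℝ} (hA : A ⊆ realBox (n + 1) M)
    {i : Fin (n + 1)} {x' : Fin n → ℝ} {t : ℝ} (ht : t ∈ fibre i A x') :
    x' ∈ Icc (fun _ : Fin n => -M) (fun _ => M) := by
  have h := hA ht
  exact ⟨fun j => by simpa using h.1 (i.succAbove j), fun j => by simpa using h.2 (i.succAbove j)⟩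

/-- Fibrewise comparison of volumes (Cavalieri): if every `i`-fibre of `B` is at most `1` longer
than that of `A`, and only over `P`, then `vol B ≤ vol A + vol P`. Only `B` needs to be
(null-)measurable. [folklore] -/
theorem volume_le_of_fibre (i : Fin (n + 1)) {A B : Set (Fin (n + 1) → ℝ)}
    (hB : NullMeasurableSet B volume) {P : Set (Fin n → ℝ)} (hP : MeasurableSet P)
    (h : ∀ x', volume (fibre i B x') ≤ volume (fibre i A x') + P.indicator 1 x') :
    volume B ≤ volume A + volume P := by
  set e := MeasurableEquiv.piFinSuccAbove (fun _ : Fin (n + 1) => ℝ) i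
  have he : MeasurePreserving e volume ((volume : Measure ℝ).prod (volume : Measure (Fin n → ℝ))) :=
    volume_preserving_piFinSuccAbove _ i
  have hes := he.symm e
  have hfib : ∀ (A : Set (Fin (n + 1) → ℝ)) (x' : Fin n → ℝ),
      (fun t : ℝ => (t, x')) ⁻¹' (e.symm ⁻¹' A) = fibre i A x' := by
    intro A x'; ext t
    simp [e, fibre, MeasurableEquiv.piFinSuccAbove_symm_apply, Fin.insertNthEquiv]
  have hBn : NullMeasurableSet (e.symm ⁻¹' B) ((volume : Measure ℝ).prod volume) :=
    hB.preimage hes.quasiMeasurePreserving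
  calc volume B = (volume.prod volume) (e.symm ⁻¹' B) := (hes.measure_preimage_equiv B).symm
    _ ≤ ∫⁻ x', volume ((fun t : ℝ => (t, x')) ⁻¹' (e.symm ⁻¹' B)) := le_lintegral_fibre hBn
    _ ≤ ∫⁻ x', (volume (fibre i A x') + P.indicator 1 x') :=
        lintegral_mono fun x' => by rw [hfib]; exact h x'
    _ = (∫⁻ x', volume (fibre i A x')) + volume P := by
        rw [lintegral_add_right _ (measurable_one.indicator hP), lintegral_indicator_one hP]
    _ ≤ volume A + volume P := by
        gcongr
        calc ∫⁻ x', volume (fibre i A x')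
              = ∫⁻ x', volume ((fun t : ℝ => (t, x')) ⁻¹' (e.symm ⁻¹' A)) := by simp_rw [hfib]
          _ ≤ (volume.prod volume) (e.symm ⁻¹' A) := lintegral_fibre_le _
          _ = volume A := hes.measure_preimage_equiv A

/-! ### Partial cubes, outer and inner parallel sets -/

/-- The partial cube `∑_{j ∈ T} [-1/2, 1/2] e_j`. [folklore] -/
def pcube (T : Finset (Fin (n + 1))) : Set (Fin (n + 1) → ℝ) :=
  Set.pi Set.univ fun j => if j ∈ T then Icc (-(1 / 2 : ℝ)) (1 / 2) else {0}

/-- Membership in the partial cube, coordinatewise. [folklore] -/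
theorem mem_pcube {T : Finset (Fin (n + 1))} {z : Fin (n + 1) → ℝ} :
    z ∈ pcube T ↔ ∀ j, (j ∈ T → |z j| ≤ 1 / 2) ∧ (j ∉ T → z j = 0) := by
  simp only [pcube, mem_univ_pi]
  refine forall_congr' fun j => ?_
  split_ifs with hj <;> simp [hj, abs_le]

/-- Partial cubes are convex. [folklore] -/
theorem convex_pcube (T : Finset (Fin (n + 1))) : Convex ℝ (pcube T) :=
  convex_pi fun j _ => by
    show Convex ℝ (if j ∈ T then Icc (-(1 / 2 : ℝ)) (1 / 2) else {0})
    split_ifs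
    exacts [convex_Icc _ _, convex_singleton _]

/-- The partial cube on no directions is `{0}`. [folklore] -/
theorem eq_zero_of_mem_pcube_empty {z : Fin (n + 1) → ℝ} (hz : z ∈ pcube ∅) : z = 0 :=
  funext fun j => (mem_pcube.1 hz j).2 (by simp)

/-- Partial cubes lie in `[-1/2, 1/2]^{n+1}`. [folklore] -/
theorem abs_le_of_mem_pcube {T : Finset (Fin (n + 1))} {z : Fin (n + 1) → ℝ} (hz : z ∈ pcube T)
    (j : Fin (n + 1)) : |z j| ≤ 1 / 2 := by
  obtain ⟨h1, h2⟩ := mem_pcube.1 hz j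
  by_cases hj : j ∈ T
  · exact h1 hj
  · rw [h2 hj, abs_zero]; norm_num

/-- Killing the new coordinate maps `pcube (insert i T)` to `pcube T`. [folklore] -/
theorem update_mem_pcube {T : Finset (Fin (n + 1))} {i : Fin (n + 1)} (hi : i ∉ T)
    {z : Fin (n + 1) → ℝ} (hz : z ∈ pcube (insert i T)) : Function.update z i 0 ∈ pcube T := by
  rw [mem_pcube] at hz ⊢
  intro j
  rcases eq_or_ne j i with rfl | hji
  · simp [hi]
  · rw [Function.update_of_ne hji]
    have := hz j
    simp only [Finset.mem_insert, hji, false_or] at this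
    exact this

/-- The outer parallel set `K + pcube T`. [folklore] -/
def outer (K : Set (Fin (n + 1) → ℝ)) (T : Finset (Fin (n + 1))) : Set (Fin (n + 1) → ℝ) :=
  K + pcube T

/-- The inner parallel set `{x | x + pcube T ⊆ K}`. [folklore] -/
def inner (K : Set (Fin (n + 1) → ℝ)) (T : Finset (Fin (n + 1))) : Set (Fin (n + 1) → ℝ) :=
  {x | ∀ z ∈ pcube T, x + z ∈ K}

variable {K : Set (Fin (n + 1) → ℝ)} {N : ℝ}

/-- Outer parallel sets of convex sets are convex. [folklore] -/
theorem convex_outer (hK : Convex ℝ K) (T : Finset (Fin (n + 1))) : Convex ℝ (outer K T) :=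
  hK.add (convex_pcube T)

/-- Inner parallel sets of convex sets are convex. [folklore] -/
theorem convex_inner (hK : Convex ℝ K) (T : Finset (Fin (n + 1))) : Convex ℝ (inner K T) := by
  intro x hx y hy a b ha hb hab z hz
  have h := hK (hx z hz) (hy z hz) ha hb hab
  have : a • (x + z) + b • (y + z) = a • x + b • y + z := by
    calc a • (x + z) + b • (y + z) = a • x + b • y + (a + b) • z := by
          simp only [smul_add, add_smul]; abel
      _ = a • x + b • y + z := by rw [hab, one_smul]
  rwa [this] at h

/-- Outer parallel sets of `K ⊆ [-N, N]^{n+1}` lie in `[-(N+1), N+1]^{n+1}`. [folklore] -/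
theorem outer_subset_realBox (hKN : K ⊆ realBox (n + 1) N) (T : Finset (Fin (n + 1))) :
    outer K T ⊆ realBox (n + 1) (N + 1) := by
  rintro x hx
  obtain ⟨y, hy, z, hz, rfl⟩ := Set.mem_add.1 hx
  have hy' := hKN hy
  constructor
  · intro j
    have h1 := abs_le_of_mem_pcube hz j
    have h2 : -N ≤ y j := hy'.1 j
    rw [abs_le] at h1
    simp only [Pi.add_apply]
    linarith
  · intro j
    have h1 := abs_le_of_mem_pcube hz j
    have h2 : y j ≤ N := hy'.2 j
    rw [abs_le] at h1
    simp only [Pi.add_apply]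
    linarith

/-- Inner parallel sets are subsets. [folklore] -/
theorem inner_subset (T : Finset (Fin (n + 1))) : inner K T ⊆ K := fun x hx => by
  simpa using hx 0 (mem_pcube.2 fun j => ⟨fun _ => by simp, fun _ => rfl⟩)

/-- `K + pcube ∅ ⊆ K`. [folklore] -/
theorem outer_empty_subset : outer K ∅ ⊆ K := by
  rintro x hx
  obtain ⟨y, hy, z, hz, rfl⟩ := Set.mem_add.1 hx
  rw [eq_zero_of_mem_pcube_empty hz, add_zero]; exact hy

/-- `K ⊆ {x | x + pcube ∅ ⊆ K}`. [folklore] -/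
theorem subset_inner_empty : K ⊆ inner K ∅ := fun x hx z hz => by
  rw [eq_zero_of_mem_pcube_empty hz, add_zero]; exact hx

/-- One thickening step. [folklore] -/
theorem volume_outer_insert_le (hK : Convex ℝ K) (hKN : K ⊆ realBox (n + 1) N)
    {T : Finset (Fin (n + 1))} {i : Fin (n + 1)} (hi : i ∉ T) :
    volume (outer K (insert i T)) ≤
      volume (outer K T) + volume (Icc (fun _ : Fin n => -(N + 1)) (fun _ => N + 1)) := by
  refine volume_le_of_fibre i ((convex_outer hK _).nullMeasurableSet _) measurableSet_Icc
    fun x' => ?_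
  set S := fibre i (outer K T) x' with hS_def
  have hsub : fibre i (outer K (insert i T)) x' ⊆ {t | ∃ s ∈ S, |t - s| ≤ 1 / 2} := by
    intro t ht
    obtain ⟨y, hy, z, hz, hyz⟩ := Set.mem_add.1 ht
    refine ⟨t - z i, ?_, ?_⟩
    · rw [hS_def, mem_fibre]
      have key : i.insertNth (t - z i) x' = y + Function.update z i 0 := by
        refine Fin.insertNth_eq_iff.2 ⟨?_, ?_⟩
        · have h := congr_fun hyz i
          simp only [Pi.add_apply, Fin.insertNth_apply_same] at h
          simp only [Pi.add_apply, Function.update_self]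
          linarith
        · ext j
          have h := congr_fun hyz (i.succAbove j)
          simp only [Pi.add_apply, Fin.insertNth_apply_succAbove] at h
          simp only [Fin.removeNth, Pi.add_apply,
            Function.update_of_ne (Fin.succAbove_ne i j)]
          exact h.symm
      rw [key]
      exact Set.add_mem_add hy (update_mem_pcube hi hz)
    · have h := abs_le_of_mem_pcube hz i
      simpa using h
  rcases S.eq_empty_or_nonempty with hS | hS
  · have : fibre i (outer K (insert i T)) x' = ∅ :=
      Set.eq_empty_of_subset_empty (hsub.trans (by simp [hS]))
    simp [this]
  · obtain ⟨s, hs⟩ := hS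
    have hbox := outer_subset_realBox hKN T
    rw [Set.indicator_of_mem (mem_Icc_of_mem_fibre hbox hs), Pi.one_apply]
    have hSI := fibre_subset_Icc hbox i x'
    calc volume (fibre i (outer K (insert i T)) x')
          ≤ volume {t | ∃ s ∈ S, |t - s| ≤ 1 / 2} := measure_mono hsub
      _ ≤ volume S + 1 := volume_thick_le (ordConnected_fibre i (convex_outer hK T) x') ⟨s, hs⟩
          (bddBelow_Icc.mono hSI) (bddAbove_Icc.mono hSI)

/-- One thinning step. [folklore] -/
theorem volume_inner_le_insert (hK : Convex ℝ K) (hKN : K ⊆ realBox (n + 1) N)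
    {T : Finset (Fin (n + 1))} {i : Fin (n + 1)} (hi : i ∉ T) :
    volume (inner K T) ≤
      volume (inner K (insert i T)) + volume (Icc (fun _ : Fin n => -N) (fun _ => N)) := by
  refine volume_le_of_fibre i ((convex_inner hK _).nullMeasurableSet _) measurableSet_Icc
    fun x' => ?_
  set S := fibre i (inner K T) x' with hS_def
  have hsub : {t | ∀ s, |t - s| ≤ 1 / 2 → s ∈ S} ⊆ fibre i (inner K (insert i T)) x' := by
    intro t ht z hz
    have h1 : t + z i ∈ S := ht _ (by simpa using abs_le_of_mem_pcube hz i)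
    rw [hS_def, mem_fibre] at h1
    have h2 := h1 _ (update_mem_pcube hi hz)
    have key : i.insertNth (t + z i) x' + Function.update z i 0 = i.insertNth t x' + z := by
      symm
      rw [funext_iff, Fin.forall_iff_succAbove i]
      constructor
      · simp
      · intro j
        simp
    rwa [key] at h2
  rcases S.eq_empty_or_nonempty with hS | hS
  · rw [hS, measure_empty]; exact bot_le
  · obtain ⟨s, hs⟩ := hS
    have hbox : inner K T ⊆ realBox (n + 1) N := (inner_subset T).trans hKN
    rw [Set.indicator_of_mem (mem_Icc_of_mem_fibre hbox hs), Pi.one_apply]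
    have hSI := fibre_subset_Icc hbox i x'
    calc volume S ≤ volume {t | ∀ s, |t - s| ≤ 1 / 2 → s ∈ S} + 1 :=
          volume_le_thin (ordConnected_fibre i (convex_inner hK T) x') ⟨s, hs⟩
            (bddBelow_Icc.mono hSI) (bddAbove_Icc.mono hSI)
      _ ≤ _ := by gcongr

/-- All thickening steps. [folklore] -/
theorem volume_outer_le (hK : Convex ℝ K) (hKN : K ⊆ realBox (n + 1) N)
    (T : Finset (Fin (n + 1))) :
    volume (outer K T) ≤
      volume K + T.card * volume (Icc (fun _ : Fin n => -(N + 1)) (fun _ => N + 1)) := by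
  induction T using Finset.induction_on with
  | empty => simpa using measure_mono (outer_empty_subset (K := K))
  | insert i T hi ih =>
    calc volume (outer K (insert i T))
          ≤ volume (outer K T) + volume (Icc (fun _ : Fin n => -(N + 1)) (fun _ => N + 1)) :=
          volume_outer_insert_le hK hKN hi
      _ ≤ volume K + T.card * volume (Icc (fun _ : Fin n => -(N + 1)) (fun _ => N + 1)) +
            volume (Icc (fun _ : Fin n => -(N + 1)) (fun _ => N + 1)) := by gcongr
      _ = _ := by rw [Finset.card_insert_of_notMem hi]; push_cast; ring

/-- All thinning steps. [folklore] -/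
theorem volume_le_inner (hK : Convex ℝ K) (hKN : K ⊆ realBox (n + 1) N)
    (T : Finset (Fin (n + 1))) :
    volume K ≤ volume (inner K T) + T.card * volume (Icc (fun _ : Fin n => -N) (fun _ => N)) := by
  induction T using Finset.induction_on with
  | empty => simpa using measure_mono (subset_inner_empty (K := K))
  | insert i T hi ih =>
    calc volume K ≤ volume (inner K T) + T.card * volume (Icc (fun _ : Fin n => -N) (fun _ => N)) :=
          ih
      _ ≤ volume (inner K (insert i T)) + volume (Icc (fun _ : Fin n => -N) (fun _ => N)) +
            T.card * volume (Icc (fun _ : Fin n => -N) (fun _ => N)) := by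
          gcongr; exact volume_inner_le_insert hK hKN hi
      _ = _ := by rw [Finset.card_insert_of_notMem hi]; push_cast; ring

/-! ### Packing unit cubes -/

open Classical in
/-- Gauss: disjoint half-open unit cubes around the lattice points of `K` lie in `K + [-1/2,1/2]^d`.
[cite: GreenTao2010, App. A (display after Cor. A.2)] -/
theorem card_le_volume_outer {N : ℕ} (K : Set (Fin (n + 1) → ℝ)) :
    (#((latticeBox (n + 1) N).filter fun m => realPoint m ∈ K) : ℝ≥0∞) ≤
      volume (outer K Finset.univ) := by
  set S := (latticeBox (n + 1) N).filter fun m => realPoint m ∈ K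
  let Q : (Fin (n + 1) → ℤ) → Set (Fin (n + 1) → ℝ) := fun m =>
    Set.pi Set.univ fun j => Ico ((m j : ℝ) - 1 / 2) ((m j : ℝ) + 1 / 2)
  have hQm : ∀ m, MeasurableSet (Q m) := fun m => MeasurableSet.univ_pi fun j => measurableSet_Ico
  have hQv : ∀ m, volume (Q m) = 1 := fun m => by
    simp only [Q, Real.volume_pi_Ico]; norm_num
  have hdisj : (S : Set (Fin (n + 1) → ℤ)).PairwiseDisjoint Q := by
    intro m _ m' _ hne
    rw [Function.onFun, Set.disjoint_left]
    intro x hx hx'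
    apply hne
    funext j
    have h1 := mem_univ_pi.1 hx j
    have h2 := mem_univ_pi.1 hx' j
    simp only [Set.mem_Ico] at h1 h2
    have h3 : ((m j : ℤ) : ℝ) < m' j + 1 := by linarith
    have h4 : ((m' j : ℤ) : ℝ) < m j + 1 := by linarith
    have h3' : m j < m' j + 1 := by exact_mod_cast h3
    have h4' : m' j < m j + 1 := by exact_mod_cast h4
    omega
  have hsub : (⋃ m ∈ S, Q m) ⊆ outer K Finset.univ := by
    intro x hx
    simp only [Set.mem_iUnion] at hx
    obtain ⟨m, hm, hx⟩ := hx
    have hmK : realPoint m ∈ K := (Finset.mem_filter.1 hm).2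
    refine Set.mem_add.2 ⟨realPoint m, hmK, x - realPoint m, ?_, add_sub_cancel _ _⟩
    rw [mem_pcube]
    intro j
    refine ⟨fun _ => ?_, fun h => absurd (Finset.mem_univ j) h⟩
    have h := mem_univ_pi.1 hx j
    simp only [Set.mem_Ico] at h
    simp only [Pi.sub_apply, realPoint]
    rw [abs_le]
    constructor <;> linarith
  calc (#S : ℝ≥0∞) = ∑ m ∈ S, volume (Q m) := by simp [hQv]
    _ = volume (⋃ m ∈ S, Q m) := (measure_biUnion_finset hdisj fun m _ => hQm m).symm
    _ ≤ _ := measure_mono hsub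

open Classical in
/-- Gauss: `{x | x + [-1/2,1/2]^d ⊆ K}` is covered by the closed unit cubes around the lattice
points of `K` (round each coordinate). [cite: GreenTao2010, App. A (display after Cor. A.2)] -/
theorem volume_inner_le_card {N : ℕ} {K : Set (Fin (n + 1) → ℝ)} (hKN : K ⊆ realBox (n + 1) N) :
    volume (inner K Finset.univ) ≤
      (#((latticeBox (n + 1) N).filter fun m => realPoint m ∈ K) : ℝ≥0∞) := by
  set S := (latticeBox (n + 1) N).filter fun m => realPoint m ∈ K
  let Q : (Fin (n + 1) → ℤ) → Set (Fin (n + 1) → ℝ) := fun m =>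
    Icc (fun j => (m j : ℝ) - 1 / 2) (fun j => (m j : ℝ) + 1 / 2)
  have hQv : ∀ m, volume (Q m) = 1 := fun m => by
    simp only [Q, Real.volume_Icc_pi]; norm_num
  have hsub : inner K Finset.univ ⊆ ⋃ m ∈ S, Q m := by
    intro x hx
    set m : Fin (n + 1) → ℤ := fun j => round (x j) with hm_def
    have hround : ∀ j, |x j - m j| ≤ 1 / 2 := fun j => abs_sub_round (x j)
    have hz : (realPoint m - x) ∈ pcube (Finset.univ : Finset (Fin (n + 1))) := by
      rw [mem_pcube]
      intro j
      refine ⟨fun _ => ?_, fun h => absurd (Finset.mem_univ j) h⟩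
      simp only [Pi.sub_apply, realPoint]
      rw [abs_sub_comm]
      exact hround j
    have hmK : realPoint m ∈ K := by
      have := hx _ hz
      rwa [add_sub_cancel] at this
    have hmS : m ∈ S := by
      refine Finset.mem_filter.2 ⟨?_, hmK⟩
      have hb := hKN hmK
      simp only [latticeBox, Fintype.mem_piFinset, Finset.mem_Icc]
      intro j
      constructor
      · have h : -(N : ℝ) ≤ (m j : ℝ) := hb.1 j
        exact_mod_cast h
      · have h : (m j : ℝ) ≤ N := hb.2 j
        exact_mod_cast h
    refine Set.mem_biUnion hmS ⟨fun j => ?_, fun j => ?_⟩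
    · have h := hround j
      rw [abs_le] at h
      linarith [h.2]
    · have h := hround j
      rw [abs_le] at h
      linarith [h.1]
  calc volume (inner K Finset.univ) ≤ volume (⋃ m ∈ S, Q m) := measure_mono hsub
    _ ≤ ∑ m ∈ S, volume (Q m) := measure_biUnion_finset_le S Q
    _ = #S := by simp [hQv]

/-! ### Assembly -/

open Classical in
/-- The lattice-point count in dimension `n + 1` with the explicit constant `(n+1) 4^n`.
[cite: GreenTao2010, App. A (display after Cor. A.2)] -/
theorem abs_card_sub_volume_le (n : ℕ) {N : ℕ} (hN : 1 ≤ N) (K : Set (Fin (n + 1) → ℝ))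
    (hK : Convex ℝ K) (hKN : K ⊆ realBox (n + 1) N) :
    |(#((latticeBox (n + 1) N).filter fun m => realPoint m ∈ K) : ℝ) - (volume K).toReal| ≤
      ((n + 1) * 4 ^ n) * (N : ℝ) ^ n := by
  set c := #((latticeBox (n + 1) N).filter fun m => realPoint m ∈ K)
  set B₁ : Set (Fin n → ℝ) := Icc (fun _ : Fin n => -((N : ℝ) + 1)) (fun _ => (N : ℝ) + 1)
  set B₀ : Set (Fin n → ℝ) := Icc (fun _ : Fin n => -(N : ℝ)) (fun _ => (N : ℝ))
  have hN' : (1 : ℝ) ≤ N := by exact_mod_cast hN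
  have hB₁ : (volume B₁).toReal = (2 * (N + 1)) ^ n := by
    rw [Real.volume_Icc_pi_toReal (fun _ => by linarith)]
    simp only [Finset.prod_const, Finset.card_univ, Fintype.card_fin]
    ring
  have hB₀ : (volume B₀).toReal = (2 * N) ^ n := by
    rw [Real.volume_Icc_pi_toReal (fun _ => by linarith)]
    simp only [Finset.prod_const, Finset.card_univ, Fintype.card_fin]
    ring
  have hB₁t : volume B₁ ≠ ⊤ := isCompact_Icc.measure_lt_top.ne
  have hB₀t : volume B₀ ≠ ⊤ := isCompact_Icc.measure_lt_top.ne
  have hKt : volume K ≠ ⊤ :=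
    ((measure_mono hKN).trans_lt (isCompact_Icc.measure_lt_top)).ne
  have hcard : (Finset.univ : Finset (Fin (n + 1))).card = n + 1 := by simp
  have h1 : (c : ℝ≥0∞) ≤ volume K + (n + 1 : ℕ) * volume B₁ := by
    have := (card_le_volume_outer (N := N) K).trans (volume_outer_le hK hKN Finset.univ)
    rwa [hcard] at this
  have h2 : volume K ≤ c + (n + 1 : ℕ) * volume B₀ := by
    have := volume_le_inner hK hKN Finset.univ
    rw [hcard] at this
    exact this.trans (by gcongr; exact volume_inner_le_card hKN)
  have h1' : (c : ℝ) ≤ (volume K).toReal + (n + 1) * (2 * (N + 1)) ^ n := by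
    have := ENNReal.toReal_mono (by finiteness) h1
    rw [ENNReal.toReal_add hKt (by finiteness), ENNReal.toReal_mul, hB₁] at this
    simp only [ENNReal.toReal_natCast] at this
    push_cast at this
    exact this
  have h2' : (volume K).toReal ≤ c + (n + 1) * (2 * N) ^ n := by
    have := ENNReal.toReal_mono (by finiteness) h2
    rw [ENNReal.toReal_add (by finiteness) (by finiteness), ENNReal.toReal_mul, hB₀] at this
    simp only [ENNReal.toReal_natCast] at this
    push_cast at this
    exact this
  have hp1 : (2 * ((N : ℝ) + 1)) ^ n ≤ 4 ^ n * (N : ℝ) ^ n := by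
    rw [← mul_pow]; exact pow_le_pow_left₀ (by positivity) (by linarith) n
  have hp0 : (2 * (N : ℝ)) ^ n ≤ 4 ^ n * (N : ℝ) ^ n := by
    rw [← mul_pow]; exact pow_le_pow_left₀ (by positivity) (by linarith) n
  have hn : (0 : ℝ) ≤ n + 1 := by positivity
  rw [abs_sub_le_iff]
  constructor <;> nlinarith [mul_le_mul_of_nonneg_left hp1 hn, mul_le_mul_of_nonneg_left hp0 hn]

end LatticePointsConvexBody

/-- **Discharge** of `GreenTao2010_latticePointsConvexBody` (Green–Tao 2010, App. A, the display
after Cor. A.2: `|K ∩ ℤ^d| = vol_d(K) + O_d(N^{d-1})` for convex `K ⊆ [-N, N]^d`), with the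
explicit constant `C(d) = d · 4^{d-1}`. The proof is the elementary Cavalieri argument of
`Literature.LatticePointsConvexBody` (section docstring above), not the surface-area route of the source.
[cite: GreenTao2010, App. A (display after Cor. A.2)] -/
theorem GreenTao2010_latticePointsConvexBody_holds : GreenTao2010_latticePointsConvexBody := by
  intro d hd
  obtain ⟨n, rfl⟩ : ∃ n, d = n + 1 := ⟨d - 1, by omega⟩
  refine ⟨(n + 1) * 4 ^ n, fun N hN K hK hKN => ?_⟩
  simpa using LatticePointsConvexBody.abs_card_sub_volume_le n hN K hK hKN

end Literature.NumberTheory.Sieve
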